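import Summits.FinalStateConjecture.FinalStateConjecture.Theses.KillingDefectSpacetimeBound
import Literature.Geometry.Lorentzian.KerrConvergenceProofs

/-!
# `DefectCoercivity` (crux stmt-FinalStateConjecture-18632, route KillingDefectSpacetimeBound):
# the LE-weighted leaf deviation `leafDev` vanishes on junk re-chartings
# (negative-side support, refuter seat `rattack`)

The crux `DefectCoercivity` bounds `leafDev(σ)²` (the "parameter-fitted, gauge-invariant,
LE-weighted `Cᵏ` leaf deviation" of `HyperboloidalDefectFoliation.lean`) by the space-time size of
the stationarity defect. This file records, kernel-checked, why that inequality carries no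
information as typed: the infimum defining `Spacetime.leafDev` runs over re-chartings `Φ` of the
band that are tied to the reference chart `Ψ` only through `injOn`/`covers`, while the local-energy
weight `(1 + ‖y‖)⁻¹` of `leSupCkENorm` is evaluated at the coordinate `y` OF THE RE-CHARTING.
Dilating the re-charting (`Φ_R(z) = R⁻¹ z`, `R → ∞`) pushes the measured set `Φ_R⁻¹(Ψ(band))` out
to `‖y‖ > R M₀`, where the weight is `< (R M₀)⁻¹`, the pulled-back metric `R⁻² η` and the fitted
Kerr–Schild background `g_{1,0}` have uniformly bounded derivatives; so the weighted deviation is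
`O(1/R)` and the infimum is `0`.

Main results (small model: Minkowski space `(E4, η)` charted by the inclusion of the hyperboloidal
Kerr-star region `B♯(M₀, a₀).domain ⊆ E4`, any `M₀ > 0`, any `a₀`):

* `leSupCkENorm_scaleRechart_le` — with the fitted parameters PINNED at unit-mass Schwarzschild
  `(M, a) = (1, 0)`, the measured LE-weighted `Cᵏ` deviation of the dilated re-charting `Φ_R` is
  `≤ K / (R M₀)` for all large `R`;
* `leafDev_minkowski_eq_zero` — hence `leafDev M₀ a₀ Ψ χ k τ = 0` for every order `k`, every leaf
  `τ` and every margin `χ ≥ 0`, although `η` is at sup-distance `≍ 2M₀/r` from `g_{M₀,a₀}` on the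
  band and at unweighted `C⁰`-distance `≥ 2/r` from the pinned `g_{1,0}`.

Consequence for the crux (recorded in the item's evidence note, not provable here in full
generality only for lack of bookkeeping): the same dilation makes `leafDev ≡ 0` for every chart
whose pulled-back metric has bounded `Cᵏ` components on the band (guaranteed by
`IsHypKerrFoliation.ckBound`), so the left side of `DefectCoercivity` is `0² = 0` and the statement
holds with `k₃ = 0, δ₀ = 1, L = 4, C = 0` independently of the Einstein equations; likewise the
smallness hypotheses `leafDev ≤ δ₀` of the sibling cruxes are void. Repair (planner): evaluate the
weight at the `Ψ`-coordinate of the measured point and constrain the fit (`M` comparable to `M₀`,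
`Φ` tied to `Ψ`), see the evidence note `TRIVIALITY.md` on the item.

Nothing here closes or refutes the crux (it is trivially TRUE as typed, hence not refutable).
-/

noncomputable section

set_option linter.dupNamespace false

namespace Summit.FinalStateConjecture.FinalStateConjecture.Theorems.DefectCoercivity.Negative

open Literature.Geometry.Lorentzian
open scoped Manifold ContDiff Topology ENNReal
open Set Filter Function

/-! ### The dilated junk re-charting

No new definitions are introduced (helper file): the dilation `y ↦ R⁻¹ y` is written as the
continuous linear map `R⁻¹ • ContinuousLinearMap.id ℝ E4`, and the junk re-charting
`Φ_R : B♯(1, 0).domain → (E4, η)`, `Φ_R(z) = R⁻¹ z`, of Minkowski space from the unit-mass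
Schwarzschild Kerr-star region `{‖z⃗‖ > 1}` as the composite `⇑(R⁻¹ • id) ∘ Subtype.val`. -/

/-- `(R⁻¹ • id) y = R⁻¹ y`. -/
theorem smul_id_apply (R : ℝ) (y : E4) :
    (R⁻¹ • ContinuousLinearMap.id ℝ E4 : E4 →L[ℝ] E4) y = R⁻¹ • y := rfl

/-- The differential of `Φ_R` (as a map into Minkowski space) is the constant dilation `R⁻¹ id`. -/
theorem mfderiv_scaleRechart (R : ℝ) (z : (Kerr.hypStarBackground 1 0).domain) :
    mfderiv 𝓘(ℝ, E4) (𝓡 4) ((⇑(R⁻¹ • ContinuousLinearMap.id ℝ E4 : E4 →L[ℝ] E4) ∘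
      (Subtype.val : (Kerr.hypStarBackground 1 0).domain → E4)) :
      (Kerr.hypStarBackground 1 0).domain → Minkowski.spacetime.carrier) z =
      (R⁻¹ • ContinuousLinearMap.id ℝ E4 : E4 →L[ℝ] E4) := by
  erw [mfderiv_comp_subtypeVal', mfderiv_eq_fderiv]
  exact (R⁻¹ • ContinuousLinearMap.id ℝ E4 : E4 →L[ℝ] E4).fderiv

/-- **The pulled-back metric of the dilated re-charting is the constant `R⁻² η`.** -/
theorem chartMetric_scaleRechart (R : ℝ) (z : (Kerr.hypStarBackground 1 0).domain) :
    Minkowski.spacetime.chartMetric (Kerr.hypStarBackground 1 0)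
      (⇑(R⁻¹ • ContinuousLinearMap.id ℝ E4 : E4 →L[ℝ] E4) ∘
        (Subtype.val : (Kerr.hypStarBackground 1 0).domain → E4)) z =
      (R⁻¹ * R⁻¹) • Minkowski.bilin := by
  ext v w
  rw [Spacetime.chartMetric_apply, mfderiv_scaleRechart]
  show Minkowski.bilin ((R⁻¹ • ContinuousLinearMap.id ℝ E4 : E4 →L[ℝ] E4) v)
    ((R⁻¹ • ContinuousLinearMap.id ℝ E4 : E4 →L[ℝ] E4) w) = _
  rw [smul_id_apply, smul_id_apply]
  simp only [map_smul, smul_apply, smul_eq_mul]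
  ring

/-- On the (open) domain the extended deviation of `Φ_R` from `g_{1,0}` is
`R⁻² η − g_{1,0}`, as a germ. -/
theorem deviationExtend_scaleRechart_eventuallyEq (R : ℝ) {x : E4}
    (hx : x ∈ (Kerr.hypStarBackground 1 0).domain) :
    Minkowski.spacetime.deviationExtend (Kerr.hypStarBackground 1 0)
      (⇑(R⁻¹ • ContinuousLinearMap.id ℝ E4 : E4 →L[ℝ] E4) ∘
        (Subtype.val : (Kerr.hypStarBackground 1 0).domain → E4)) =ᶠ[𝓝 x]
      fun y ↦ (R⁻¹ * R⁻¹) • Minkowski.bilin - Kerr.bilin 1 0 y := by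
  filter_upwards [(Kerr.hypStarBackground 1 0).domain.isOpen.mem_nhds hx] with y hy
  have h1 := Spacetime.deviationExtend_coe_eq Minkowski.spacetime (Kerr.hypStarBackground 1 0)
    (⇑(R⁻¹ • ContinuousLinearMap.id ℝ E4 : E4 →L[ℝ] E4) ∘
      (Subtype.val : (Kerr.hypStarBackground 1 0).domain → E4)) ⟨y, hy⟩
  have h2 := Spacetime.chartMetricExtend_coe Minkowski.spacetime (Kerr.hypStarBackground 1 0)
    (⇑(R⁻¹ • ContinuousLinearMap.id ℝ E4 : E4 →L[ℝ] E4) ∘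
      (Subtype.val : (Kerr.hypStarBackground 1 0).domain → E4)) ⟨y, hy⟩
  rw [h2, chartMetric_scaleRechart] at h1
  exact h1

/-- **`Φ_R` is an admissible re-charting** (`IsLeafRechart`) of every unit band of the inclusion
chart `Ψ = Subtype.val : B♯(M₀, a₀).domain → E4` of Minkowski space, with fitted parameters
`(M, a) = (1, 0)`, as soon as `R M₀ > 1`: it is smooth with constant pulled-back metric, injective,
and its range `{‖y‖ > R⁻¹}` contains the whole chart domain `{r_{a₀} > M₀} ⊆ {‖y‖ > M₀}`. -/
theorem isLeafRechart_scaleRechart {M₀ R : ℝ} (a₀ τ : ℝ) (hR : 0 < R) (hRM : 1 < R * M₀) :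
    Minkowski.spacetime.IsLeafRechart M₀ a₀
      (Subtype.val : (Kerr.hypStarBackground M₀ a₀).domain → E4) τ 1 0
      (⇑(R⁻¹ • ContinuousLinearMap.id ℝ E4 : E4 →L[ℝ] E4) ∘
        (Subtype.val : (Kerr.hypStarBackground 1 0).domain → E4)) where
  contMDiff :=
    (contMDiff_iff_contDiff.mpr (R⁻¹ • ContinuousLinearMap.id ℝ E4 : E4 →L[ℝ] E4).contDiff).comp
      contMDiff_subtype_val
  contDiffOn := by
    refine (contDiffOn_const (c := (R⁻¹ * R⁻¹) • Minkowski.bilin)).congr fun y hy ↦ ?_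
    rw [← chartMetric_scaleRechart R ⟨y, hy⟩]
    exact Spacetime.chartMetricExtend_coe Minkowski.spacetime (Kerr.hypStarBackground 1 0)
      (⇑(R⁻¹ • ContinuousLinearMap.id ℝ E4 : E4 →L[ℝ] E4) ∘
      (Subtype.val : (Kerr.hypStarBackground 1 0).domain → E4)) ⟨y, hy⟩
  injOn := by
    intro z₁ _ z₂ _ h
    exact Subtype.ext (smul_right_injective E4 (inv_ne_zero hR.ne') h)
  covers := by
    rintro _ ⟨p, -, rfl⟩
    have hp : M₀ < Kerr.radius a₀ (p : E4) := Kerr.lt_radius_of_mem_region p.2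
    have hsp : M₀ < E4.spatialNorm (p : E4) := hp.trans_le (Kerr.radius_le_spatialNorm a₀ _)
    have hmem : (R • (p : E4)) ∈ (Kerr.hypStarBackground 1 0).domain := by
      show max (1 : ℝ) 0 < Kerr.radius 0 (R • (p : E4))
      rw [max_eq_left zero_le_one, Kerr.radius_zero_left, Kerr.spatialNorm_smul, abs_of_pos hR]
      calc (1 : ℝ) < R * M₀ := hRM
        _ ≤ R * E4.spatialNorm (p : E4) := by gcongr
    refine ⟨⟨R • (p : E4), hmem⟩, ?_⟩
    show (R⁻¹ • (R • (p : E4)) : E4) = p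
    rw [smul_smul, inv_mul_cancel₀ hR.ne', one_smul]

/-- Points of the measured set `Φ_R⁻¹(Ψ(band))` (in `Φ_R`-coordinates) have spatial radius
`> R M₀`: the band lies in `{r_{a₀} > M₀} ⊆ {‖y‖ > M₀}` and `Φ_R⁻¹` dilates by `R`. -/
theorem lt_spatialNorm_of_mem_measuredSet {M₀ a₀ τ R : ℝ} (hR : 0 < R) {x : E4}
    (hx : x ∈ Subtype.val '' ((⇑(R⁻¹ • ContinuousLinearMap.id ℝ E4 : E4 →L[ℝ] E4) ∘
      (Subtype.val : (Kerr.hypStarBackground 1 0).domain → E4)) ⁻¹'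
      ((Subtype.val : (Kerr.hypStarBackground M₀ a₀).domain → E4) ''
        (Kerr.hypStarBackground M₀ a₀).timeBand (Icc τ (τ + 1))))) :
    R * M₀ < E4.spatialNorm x := by
  obtain ⟨z, hz, rfl⟩ := hx
  obtain ⟨p, -, hpz⟩ := hz
  have hpz' : (p : E4) = R⁻¹ • (z : E4) := hpz
  have hp : M₀ < Kerr.radius a₀ (p : E4) := Kerr.lt_radius_of_mem_region p.2
  have h1 : M₀ < E4.spatialNorm (R⁻¹ • (z : E4)) := by
    have h := hp.trans_le (Kerr.radius_le_spatialNorm a₀ _)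
    rwa [hpz'] at h
  rw [Kerr.spatialNorm_smul, abs_of_pos (inv_pos.mpr hR)] at h1
  calc R * M₀ < R * (R⁻¹ * E4.spatialNorm (z : E4)) := by gcongr
    _ = E4.spatialNorm (z : E4) := by rw [← mul_assoc, mul_inv_cancel₀ hR.ne', one_mul]

/-! ### The measured deviation of the dilated re-charting is `O(1/R)` -/

-- the algebraic and the operator-norm instance paths on `E4 →L[ℝ] E4 →L[ℝ] ℝ` unify slowly
set_option maxSynthPendingDepth 3 in
set_option synthInstance.maxHeartbeats 200000 in
/-- **The LE-weighted `Cᵏ` deviation of Minkowski's unit band from UNIT-MASS Schwarzschild,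
measured through the dilated re-charting `Φ_R`, is `≤ K / (R M₀)`** for all `R ≥ R₀`: on the
measured set `‖y‖ > R M₀`, so the weight is `< (R M₀)⁻¹`; the deviation there is
`(R⁻² η − η) − (g_{1,0} − η)` with `‖D^m(R⁻² η − η)‖ ≤ 2` and `‖D^m (g_{1,0} − η)‖ ≤ C_m / r ≤ C_m`
(`Kerr.norm_iteratedFDeriv_ksPert_le`). The fitted mass is NOT sent to `0`: the smallness comes
from the weight alone. -/
theorem leSupCkENorm_scaleRechart_le {M₀ : ℝ} (hM₀ : 0 < M₀) (a₀ τ : ℝ) (k : ℕ) :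
    ∃ K R₀ : ℝ, 0 ≤ K ∧ M₀⁻¹ < R₀ ∧ ∀ R : ℝ, R₀ ≤ R →
      leSupCkENorm (Subtype.val '' ((⇑(R⁻¹ • ContinuousLinearMap.id ℝ E4 : E4 →L[ℝ] E4) ∘
      (Subtype.val : (Kerr.hypStarBackground 1 0).domain → E4)) ⁻¹'
        ((Subtype.val : (Kerr.hypStarBackground M₀ a₀).domain → E4) ''
          (Kerr.hypStarBackground M₀ a₀).timeBand (Icc τ (τ + 1))))) k
        (Minkowski.spacetime.deviationExtend (Kerr.hypStarBackground 1 0)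
          (⇑(R⁻¹ • ContinuousLinearMap.id ℝ E4 : E4 →L[ℝ] E4) ∘
            (Subtype.val : (Kerr.hypStarBackground 1 0).domain → E4))) ≤
      ENNReal.ofReal (K / (R * M₀)) := by
  choose C Rd hRd hC using fun m ↦ Kerr.norm_iteratedFDeriv_ksPert_le 1 0 m
  set Cmax : ℝ := ∑ m ∈ Finset.range (k + 1), |C m| with hCmax
  set Rmax : ℝ := ∑ m ∈ Finset.range (k + 1), Rd m with hRmax
  have hCm : ∀ m ≤ k, |C m| ≤ Cmax := fun m hm ↦
    Finset.single_le_sum (f := fun m ↦ |C m|) (fun _ _ ↦ abs_nonneg _)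
      (Finset.mem_range.mpr (Nat.lt_succ_of_le hm))
  have hRm : ∀ m ≤ k, Rd m ≤ Rmax := fun m hm ↦
    Finset.single_le_sum (f := Rd) (fun m _ ↦ (hRd m).le)
      (Finset.mem_range.mpr (Nat.lt_succ_of_le hm))
  have hRmax0 : 0 < Rmax := (hRd 0).trans_le (hRm 0 (Nat.zero_le k))
  have hCmax0 : 0 ≤ Cmax := Finset.sum_nonneg fun _ _ ↦ abs_nonneg _
  refine ⟨2 + Cmax, (1 + Rmax) / M₀ + 1, by positivity, ?_, fun R hR ↦ ?_⟩
  · have h1 : M₀⁻¹ < (1 + Rmax) / M₀ := by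
      rw [inv_eq_one_div]
      exact div_lt_div_of_pos_right (by linarith) hM₀
    linarith
  have hdivpos : 0 < (1 + Rmax) / M₀ := by positivity
  have hR1 : 1 ≤ R := by linarith
  have hR0 : 0 < R := one_pos.trans_le hR1
  have hRM : 1 + Rmax ≤ R * M₀ := by
    have h : (1 + Rmax) / M₀ * M₀ = 1 + Rmax := div_mul_cancel₀ _ hM₀.ne'
    nlinarith
  have hRM0 : 0 < R * M₀ := by positivity
  refine iSup₂_le fun m hm ↦ iSup₂_le fun x hx ↦ ?_
  have hs : R * M₀ < E4.spatialNorm x := lt_spatialNorm_of_mem_measuredSet hR0 hx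
  have hr : Kerr.radius 0 x = E4.spatialNorm x := Kerr.radius_zero_left x
  have hs1 : 1 ≤ E4.spatialNorm x := by linarith
  have hxU : x ∈ (Kerr.hypStarBackground 1 0).domain := by
    show max (1 : ℝ) 0 < Kerr.radius 0 x
    rw [max_eq_left zero_le_one, hr]
    linarith
  have hr0 : 0 < Kerr.radius 0 x := by rw [hr]; linarith
  -- the weight
  have hw : leWeight x ≤ ENNReal.ofReal (R * M₀)⁻¹ := by
    refine ENNReal.ofReal_le_ofReal (inv_anti₀ hRM0 ?_)
    change R * M₀ < ‖E4.spatial x‖ at hs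
    linarith [norm_nonneg (E4.spatial x)]
  -- the germ of the deviation and its splitting
  rw [((deviationExtend_scaleRechart_eventuallyEq R hxU).iteratedFDeriv ℝ m).eq_of_nhds]
  set c : E4 →L[ℝ] E4 →L[ℝ] ℝ := (R⁻¹ * R⁻¹) • Minkowski.bilin - Minkowski.bilin with hc
  have hsplit : (fun y ↦ (R⁻¹ * R⁻¹) • Minkowski.bilin - Kerr.bilin 1 0 y) =
      (fun _ : E4 ↦ c) + -(fun y ↦ Kerr.bilin 1 0 y - Minkowski.bilin) := by
    funext y
    simp only [hc, Pi.add_apply, Pi.neg_apply]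
    abel
  rw [hsplit]
  have hf : ContDiffAt ℝ m (fun _ : E4 ↦ c) x := contDiffAt_const
  have hg : ContDiffAt ℝ m (-(fun y ↦ Kerr.bilin 1 0 y - Minkowski.bilin)) x :=
    (Kerr.contDiffAt_ksPert hr0).neg
  -- the constant part
  have hc2 : ‖c‖ ≤ 2 := by
    have hinv : R⁻¹ ≤ 1 := inv_le_one_of_one_le₀ hR1
    have hinv0 : 0 ≤ R⁻¹ := inv_nonneg.mpr hR0.le
    have hsq : |R⁻¹ * R⁻¹| ≤ 1 := by
      rw [abs_of_nonneg (mul_nonneg hinv0 hinv0)]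
      exact mul_le_one₀ hinv hinv0 hinv
    calc ‖c‖ = ‖(R⁻¹ * R⁻¹) • Minkowski.bilin - Minkowski.bilin‖ := rfl
      _ ≤ ‖(R⁻¹ * R⁻¹) • Minkowski.bilin‖ + ‖Minkowski.bilin‖ := norm_sub_le _ _
      _ = |R⁻¹ * R⁻¹| * ‖Minkowski.bilin‖ + ‖Minkowski.bilin‖ := by
          rw [norm_smul, Real.norm_eq_abs]
      _ ≤ 1 * 1 + 1 := by
          gcongr
          · exact Minkowski.norm_bilin_le_one
          · exact Minkowski.norm_bilin_le_one
      _ = 2 := by norm_num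
  have hconst : ‖iteratedFDeriv ℝ m (fun _ : E4 ↦ c) x‖ ≤ 2 := by
    rcases Nat.eq_zero_or_pos m with rfl | hm0
    · rwa [norm_iteratedFDeriv_zero]
    · rw [iteratedFDeriv_const_of_ne hm0.ne']
      simp
  -- the Kerr–Schild part
  have hks : ‖iteratedFDeriv ℝ m (-(fun y ↦ Kerr.bilin 1 0 y - Minkowski.bilin)) x‖ ≤ Cmax := by
    rw [iteratedFDeriv_neg_apply, norm_neg]
    have hRle : Rd m ≤ Kerr.radius 0 x := by
      rw [hr]
      linarith [hRm m hm]
    have hr1 : 1 ≤ Kerr.radius 0 x := by rwa [hr]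
    calc (‖iteratedFDeriv ℝ m (fun y ↦ Kerr.bilin 1 0 y - Minkowski.bilin) x‖ : ℝ)
        ≤ C m / Kerr.radius 0 x := hC m x hRle
      _ ≤ |C m| / Kerr.radius 0 x := by gcongr; exact le_abs_self _
      _ ≤ |C m| := div_le_self (abs_nonneg _) hr1
      _ ≤ Cmax := hCm m hm
  calc leWeight x * ‖iteratedFDeriv ℝ m
        ((fun _ : E4 ↦ c) + -(fun y ↦ Kerr.bilin 1 0 y - Minkowski.bilin)) x‖ₑ
      ≤ ENNReal.ofReal (R * M₀)⁻¹ * (‖iteratedFDeriv ℝ m (fun _ : E4 ↦ c) x‖ₑ +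
          ‖iteratedFDeriv ℝ m (-(fun y ↦ Kerr.bilin 1 0 y - Minkowski.bilin)) x‖ₑ) :=
        mul_le_mul' hw (enorm_iteratedFDeriv_add_le hf hg)
    _ ≤ ENNReal.ofReal (R * M₀)⁻¹ * (ENNReal.ofReal 2 + ENNReal.ofReal Cmax) := by
        gcongr
        · exact enorm_le_ofReal_of_norm_le hconst
        · exact enorm_le_ofReal_of_norm_le hks
    _ = ENNReal.ofReal ((2 + Cmax) / (R * M₀)) := by
        rw [← ENNReal.ofReal_add zero_le_two hCmax0,
          ← ENNReal.ofReal_mul (inv_nonneg.mpr hRM0.le), div_eq_inv_mul]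

/-! ### The leaf deviation of Minkowski space vanishes -/

/-- **`leafDev ≡ 0` for Minkowski space, for EVERY reference mass `M₀ > 0`.** The LE-weighted,
parameter-fitted leaf deviation of the inclusion chart of Minkowski space on `B♯(M₀, a₀).domain`
from the sub-extremal Kerr family with margin `χ ≥ 0` vanishes at every order `k` and every leaf
`τ` — witnessed with the fit PINNED at `(M, a) = (1, 0)` and the dilated re-chartings `Φ_R`,
`R → ∞` (`leSupCkENorm_scaleRechart_le`, `leafDev_le`), i.e. by the degeneracy of the weight,
not by sending the fitted mass to `0`. -/
theorem leafDev_minkowski_eq_zero {M₀ : ℝ} (hM₀ : 0 < M₀) (a₀ : ℝ) {χ : ℝ} (hχ : 0 ≤ χ) (k : ℕ)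
    (τ : ℝ) :
    Minkowski.spacetime.leafDev M₀ a₀
      (Subtype.val : (Kerr.hypStarBackground M₀ a₀).domain → E4) χ k τ = 0 := by
  obtain ⟨K, R₀, -, hR₀, hbound⟩ := leSupCkENorm_scaleRechart_le hM₀ a₀ τ k
  refine le_antisymm ?_ zero_le
  have hlim : Tendsto (fun R : ℝ ↦ ENNReal.ofReal (K / (R * M₀))) atTop (𝓝 0) := by
    have h : Tendsto (fun R : ℝ ↦ K / (R * M₀)) atTop (𝓝 0) :=
      tendsto_const_nhds.div_atTop (tendsto_id.atTop_mul_const hM₀)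
    simpa using ENNReal.tendsto_ofReal h
  refine ge_of_tendsto hlim ?_
  filter_upwards [eventually_ge_atTop R₀] with R hR
  have hR0 : 0 < R := (inv_pos.mpr hM₀).trans (hR₀.trans_le hR)
  have hRM : 1 < R * M₀ := by
    have h : M₀⁻¹ * M₀ = 1 := inv_mul_cancel₀ hM₀.ne'
    nlinarith [hR₀.trans_le hR]
  have hχ' : |(0 : ℝ)| ≤ χ * 1 := by simpa using hχ
  exact (Spacetime.leafDev_le M₀ a₀ _ χ k τ one_pos hχ'
    (isLeafRechart_scaleRechart a₀ τ hR0 hRM)).trans (hbound R hR)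

end Summit.FinalStateConjecture.FinalStateConjecture.Theorems.DefectCoercivity.Negative

end
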